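import Summits.QuantumAdvantage.AdviceFreeQNC0.DWalkFibres
import Summits.QuantumAdvantage.AdviceFreeQNC0.WindowLocalHard
import Literature.Computability.MetaComplexity.LowDegreeComposition
import Mathlib.Algebra.BigOperators.Fin
import HarnessLib

/-!
# Cell qa-qnc0 (rung F-Q2-odd, `p = 3`): the Kilian gauge LIFTED TO THE INPUT BITS (ROUND-15 §3.3–3.4)

Planner qa-qnc0-p1 g16, `ROUND-15.md` §3.3–§3.4 (formalisation map L3–L4), for THEOREM A′ `PredHardDWB3`.
A window `[a, a + (m+1)L)` of the first `n` letters of a pattern `x ∈ {0,1}^{n+1}`, on which the stake weight is a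
constant `κ₀` (`KappaConst`), is cut into `m + 1` blocks of `L` letters with block words
`G_j(x) = blockPerm κ₀ (block j) ∈ S₃` (`Gblk`) and window word `P_win(x) = G_0 ⋯ G_m` (`Pwin = Fin.partialProd`,
`= wp (kappa k) (xN x) a ((m+1)L)`, `partialProd_Gblk`).

THE LIFT `psi r x` (randomness `r = (h, ρ)`: interior boundary gauges `h : Fin m → S₃`, resampling table
`ρ j g ∈ fib(g)`): replace block `j` of the window by `ρ j (h_j⁻¹ G_j(x) h_{j+1})` (`gaugedG`, `bdry`), keep every bit
outside the window.  PROVED: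
* `partialProd_gauged` — telescoping: the gauged block words have the same product, so `Pwin (psi r x) = Pwin x`
  (`Pwin_psi`), `out (psi r x) = out x`, hence **`dk3_psi : Dk3 (psi r x) k = Dk3 x k`** (the stake is a function of
  the outside bits and the window word, `dk3_eq_of_out_Pwin`) and **`odd_psi_iff`** (the odd class is preserved);
* **`comp_psi_mem_lowDeg`** — LOCALITY: every bit of `psi r x` depends on at most `L` bits of `x` (its own block), so
  `g ∘ psi r ∈ lowDeg (Δ·L)` for `g ∈ lowDeg Δ` (junta lemma `ind_mem_lowDeg_of_dependsOn` + `comp_mem_lowDeg_of_coord_mul`).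

WHAT THIS IS NOT: the averaging identities and the hardness statement are the next files; separation NOT moved.
-/

noncomputable section

namespace Summit.QuantumAdvantage.AdviceFreeQNC0

namespace DWalk

open Finset Equiv
open Literature.Computability.MetaComplexity Literature.Computability.MetaComplexity.Smolensky

section Gauge

variable {n : ℕ} (a L m : ℕ)

/-! ### Window coordinates, glueing, blocks -/
/-- The window content of `x`: `t ↦ x_{a+t}`, `t < (m+1)L` (junk beyond the pattern). -/
def winOf (x : Fin (n + 1) → Bool) : Fin ((m + 1) * L) → Bool := fun t => xN x (a + t)
/-- Replace the window content of `x` by `w`. -/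
def glue (x : Fin (n + 1) → Bool) (w : Fin ((m + 1) * L) → Bool) : Fin (n + 1) → Bool :=
  fun i => if h : a ≤ i.val ∧ i.val < a + (m + 1) * L then w ⟨i.val - a, by omega⟩ else x i
/-- The canonical representative of the outside content: the window zeroed. -/
def out (x : Fin (n + 1) → Bool) : Fin (n + 1) → Bool := glue a L m x fun _ => false
/-- Block `j` of a window content. -/
def wblk (w : Fin ((m + 1) * L) → Bool) (j : Fin (m + 1)) : Fin L → Bool := fun s => w (finProdFinEquiv (j, s))
/-- Reassemble a window content from its blocks. -/
def unblk (B : Fin (m + 1) → Fin L → Bool) : Fin ((m + 1) * L) → Bool :=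
  fun t => B (finProdFinEquiv.symm t).1 (finProdFinEquiv.symm t).2

variable {a L m}
/-- Blocks of a reassembled content. -/
@[simp] theorem wblk_unblk (B : Fin (m + 1) → Fin L → Bool) : wblk L m (unblk L m B) = B := by
  funext j s; simp [wblk, unblk]
/-- Reassembling the blocks gives the content back. -/
@[simp] theorem unblk_wblk (w : Fin ((m + 1) * L) → Bool) : unblk L m (wblk L m w) = w := by
  funext t
  simp only [unblk, wblk]
  rw [show ((finProdFinEquiv.symm t).1, (finProdFinEquiv.symm t).2) = finProdFinEquiv.symm t from rfl,
    Equiv.apply_symm_apply]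
/-- Value of `glue` inside the window. -/
theorem glue_apply_of_mem (x : Fin (n + 1) → Bool) (w : Fin ((m + 1) * L) → Bool) {i : Fin (n + 1)}
    (h : a ≤ i.val ∧ i.val < a + (m + 1) * L) : glue a L m x w i = w ⟨i.val - a, by omega⟩ := by
  unfold glue; rw [dif_pos h]
/-- Value of `glue` outside the window. -/
theorem glue_apply_of_not_mem (x : Fin (n + 1) → Bool) (w : Fin ((m + 1) * L) → Bool) {i : Fin (n + 1)}
    (h : ¬ (a ≤ i.val ∧ i.val < a + (m + 1) * L)) : glue a L m x w i = x i := by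
  unfold glue; rw [dif_neg h]
/-- Glueing twice keeps the last window content. -/
@[simp] theorem glue_glue (x : Fin (n + 1) → Bool) (w w' : Fin ((m + 1) * L) → Bool) :
    glue a L m (glue a L m x w) w' = glue a L m x w' := by
  funext i; unfold glue; split_ifs <;> rfl
/-- Reading back the window (needs the window inside the pattern). -/
theorem winOf_glue (haW : a + (m + 1) * L ≤ n) (x : Fin (n + 1) → Bool) (w : Fin ((m + 1) * L) → Bool) :
    winOf a L m (glue a L m x w) = w := by
  funext t
  simp only [winOf, xN, show a + t.val < n + 1 by omega, dif_pos]
  rw [glue_apply_of_mem x w ⟨Nat.le_add_right _ _, Nat.add_lt_add_left t.isLt a⟩]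
  congr 1; ext; simp
/-- Glueing back its own window content gives `x`. -/
theorem glue_winOf (haW : a + (m + 1) * L ≤ n) (x : Fin (n + 1) → Bool) : glue a L m x (winOf a L m x) = x := by
  funext i
  unfold glue
  split_ifs with h
  · simp only [winOf, xN]
    rw [dif_pos (by omega)]
    congr 1; ext; simp; omega
  · rfl

/-- The outside representative ignores the window content. -/
theorem out_glue (x : Fin (n + 1) → Bool) (w : Fin ((m + 1) * L) → Bool) : out a L m (glue a L m x w) = out a L m x := by
  unfold out; rw [glue_glue]

/-- Glueing onto the outside representative is glueing onto `x`. -/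
theorem glue_out (x : Fin (n + 1) → Bool) (w : Fin ((m + 1) * L) → Bool) : glue a L m (out a L m x) w = glue a L m x w := by
  unfold out; rw [glue_glue]

/-- `out` is idempotent. -/
theorem out_out (x : Fin (n + 1) → Bool) : out a L m (out a L m x) = out a L m x := out_glue x _

/-- Outside the window nothing changes (ℕ-indexed form). -/
theorem xN_glue_of_not_mem (x : Fin (n + 1) → Bool) (w : Fin ((m + 1) * L) → Bool) {i : ℕ}
    (h : ¬ (a ≤ i ∧ i < a + (m + 1) * L)) : xN (glue a L m x w) i = xN x i := by
  unfold xN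
  split_ifs with hi
  · exact glue_apply_of_not_mem x w (by simpa using h)
  · rfl

/-- Inside the window one reads the blocks (ℕ-indexed form). -/
theorem xN_glue_block (haW : a + (m + 1) * L ≤ n) (x : Fin (n + 1) → Bool) (B : Fin (m + 1) → Fin L → Bool)
    (j : Fin (m + 1)) {s : ℕ} (hs : s < L) :
    xN (glue a L m x (unblk L m B)) (a + (s + L * j.val)) = B j ⟨s, hs⟩ := by
  have hlt : s + L * j.val < (m + 1) * L := by
    have := j.isLt; nlinarith
  unfold xN
  rw [dif_pos (by omega), glue_apply_of_mem x _ (by simp; omega)]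
  have : (⟨a + (s + L * j.val) - a, by omega⟩ : Fin ((m + 1) * L)) = finProdFinEquiv (j, ⟨s, hs⟩) := by
    ext; simp
  rw [this]; simp [unblk]

/-! ### Block words and the window word -/

variable (a L m) (κ₀ : ZMod 3) (k : ℕ)

/-- `κ₀` is the (constant) stake weight on the window. -/
def KappaConst : Prop := ∀ i, a ≤ i → i < a + (m + 1) * L → kappa k i = κ₀

/-- The word of block `j` of the window of `x`. -/
def Gblk (x : Fin (n + 1) → Bool) (j : Fin (m + 1)) : Perm (ZMod 3) := blockPerm κ₀ (wblk L m (winOf a L m x) j)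

/-- The window word `G_0 ⋯ G_m`. -/
def Pwin (x : Fin (n + 1) → Bool) : Perm (ZMod 3) := Fin.partialProd (Gblk a L m κ₀ x) (Fin.last (m + 1))

variable {a L m κ₀ k}

/-- The block word is the word of the corresponding letters of `x`. -/
theorem wp_block_eq_Gblk (hκ : KappaConst a L m κ₀ k) (x : Fin (n + 1) → Bool) (j : Fin (m + 1)) :
    wp (kappa k) (xN x) (a + L * j.val) L = Gblk a L m κ₀ x j := by
  unfold Gblk blockPerm
  refine wp_congr fun t ht => ⟨?_, ?_⟩
  · have := j.isLt
    exact hκ _ (by omega) (by nlinarith)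
  · simp only [bN, ht, dif_pos, wblk, winOf, Nat.zero_add]
    congr 1
    simp; ring

/-- Partial window words: `G_0 ⋯ G_{i-1} = wp a (iL)`. -/
theorem partialProd_Gblk (hκ : KappaConst a L m κ₀ k) (x : Fin (n + 1) → Bool) :
    ∀ i : Fin (m + 2), Fin.partialProd (Gblk a L m κ₀ x) i = wp (kappa k) (xN x) a (L * i.val) := by
  intro i
  induction i using Fin.induction with
  | zero => simp
  | succ i ih =>
    rw [Fin.partialProd_succ, ih, ← wp_block_eq_Gblk hκ x i, Fin.val_succ, Fin.val_castSucc, Nat.mul_succ, wp_add]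

/-- **The window word is the word of the window letters.** -/
theorem Pwin_eq_wp (hκ : KappaConst a L m κ₀ k) (x : Fin (n + 1) → Bool) :
    Pwin a L m κ₀ x = wp (kappa k) (xN x) a ((m + 1) * L) := by
  unfold Pwin; rw [partialProd_Gblk hκ x, Fin.val_last, Nat.mul_comm]

/-- Block words only see the window: `Gblk (glue x (unblk B)) j = blockPerm κ₀ (B j)`. -/
theorem Gblk_glue_unblk (haW : a + (m + 1) * L ≤ n) (x : Fin (n + 1) → Bool) (B : Fin (m + 1) → Fin L → Bool)
    (j : Fin (m + 1)) : Gblk a L m κ₀ (glue a L m x (unblk L m B)) j = blockPerm κ₀ (B j) := by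
  unfold Gblk; rw [winOf_glue haW, wblk_unblk]

/-! ### The stake is a function of the outside bits and the window word -/

/-- Patterns that agree outside the window and have the same window word have the same stake. -/
theorem dk3_eq_of_out_Pwin (hκ : KappaConst a L m κ₀ k) (haW : a + (m + 1) * L ≤ n) (hk : k ≤ n)
    {x x' : Fin (n + 1) → Bool} (hout : ∀ i, ¬ (a ≤ i ∧ i < a + (m + 1) * L) → xN x i = xN x' i)
    (hP : Pwin a L m κ₀ x = Pwin a L m κ₀ x') : Dk3 x k = Dk3 x' k := by
  rw [dk3_eq_trW x hk, dk3_eq_trW x' hk, trW_window (kappa k) (xN x) haW, trW_window (kappa k) (xN x') haW]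
  have h1 : trW (kappa k) (xN x) 0 a = trW (kappa k) (xN x') 0 a :=
    trW_congr fun t ht => ⟨rfl, by rw [Nat.zero_add]; exact hout t (by omega)⟩
  have h2 : sgnW (xN x) 0 a = sgnW (xN x') 0 a :=
    sgnW_congr fun t ht => by rw [Nat.zero_add]; exact hout t (by omega)
  have h3 : trW (kappa k) (xN x) (a + (m + 1) * L) (n - (a + (m + 1) * L)) =
      trW (kappa k) (xN x') (a + (m + 1) * L) (n - (a + (m + 1) * L)) :=
    trW_congr fun t _ => ⟨rfl, hout _ (by omega)⟩
  -- the window data are the affine data of the window word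
  have hE : sgnW (xN x) a ((m + 1) * L) = sgnW (xN x') a ((m + 1) * L) ∧
      trW (kappa k) (xN x) a ((m + 1) * L) = trW (kappa k) (xN x') a ((m + 1) * L) := by
    have i1 := isAff_wp (kappa k) (xN x) a ((m + 1) * L)
    have i2 := isAff_wp (kappa k) (xN x') a ((m + 1) * L)
    rw [← Pwin_eq_wp hκ] at i1 i2
    rw [hP] at i1
    exact i1.unique i2
  rw [h1, h2, h3, hE.1, hE.2]

/-! ### The odd class is a function of the outside bits and the window sign -/

/-- The sign of a word is `+1` iff the number of zeros among its letters is even. -/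
theorem sgnW_eq_ite (x : ℕ → Bool) (a : ℕ) :
    ∀ l, sgnW x a l = if ((range l).filter fun t => x (a + t) = false).card % 2 = 0 then 1 else -1
  | 0 => by simp
  | l + 1 => by
    rw [sgnW_succ, sgnW_eq_ite x a l, Finset.range_add_one, Finset.filter_insert]
    have hnot : l ∉ (range l).filter fun t => x (a + t) = false := by simp
    cases hx : x (a + l)
    · -- one more zero: the parity flips and the sign is multiplied by `ỹ = −1`
      rw [if_pos rfl, Finset.card_insert_of_notMem hnot]
      have hy : yt false = -1 := rfl
      rw [hy]
      rcases Nat.mod_two_eq_zero_or_one (((range l).filter fun t => x (a + t) = false).card) with h | h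
      · rw [if_pos h, if_neg (by omega)]; norm_num
      · rw [if_neg (by omega), if_pos (by omega)]; norm_num
    · rw [if_neg (show ¬ (true = false) by decide)]
      have hy : yt true = 1 := rfl
      rw [hy, mul_one]

/-- The number of zeros of `x` splits into outside and window parts; the window part has the parity read off
from the window sign.  Consequence: membership in the odd class depends only on `(out x, sign Pwin x)`. -/
theorem card_zeros_eq (haW : a + (m + 1) * L ≤ n) (x : Fin (n + 1) → Bool) :
    (univ.filter fun j : Fin (n + 1) => x j = false).card =
      (univ.filter fun j : Fin (n + 1) => ¬ (a ≤ j.val ∧ j.val < a + (m + 1) * L) ∧ x j = false).card +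
      ((range ((m + 1) * L)).filter fun t => xN x (a + t) = false).card := by
  rw [← Finset.card_filter_add_card_filter_not (s := univ.filter fun j : Fin (n + 1) => x j = false)
    (fun j => ¬ (a ≤ j.val ∧ j.val < a + (m + 1) * L)), Finset.filter_filter, Finset.filter_filter]
  congr 1
  · congr 1; ext j; simp only [mem_filter, mem_univ, true_and]; tauto
  · -- the window zeros, reindexed by `t = j - a`
    refine Finset.card_bij' (fun j _ => j.val - a) (fun t _ => ⟨a + t, by
        have := Finset.mem_range.1 (Finset.mem_filter.1 ‹_›).1; omega⟩) ?_ ?_ ?_ ?_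
    · intro j hj
      simp only [mem_filter, mem_univ, true_and, not_not] at hj
      simp only [mem_filter, mem_range]
      refine ⟨by omega, ?_⟩
      simp only [xN, show a + (j.val - a) < n + 1 by omega, dif_pos]
      have : (⟨a + (j.val - a), by omega⟩ : Fin (n + 1)) = j := by ext; simp; omega
      rw [this]; exact hj.1
    · intro t ht
      simp only [mem_filter, mem_range] at ht
      simp only [mem_filter, mem_univ, true_and, not_not]
      refine ⟨?_, by simp; omega⟩
      have h := ht.2
      simp only [xN, show a + t < n + 1 by omega, dif_pos] at h
      exact h
    · intro j hj
      simp only [mem_filter, mem_univ, true_and, not_not] at hj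
      ext; simp; omega
    · intro t _; simp

/-- Hence: two patterns that agree outside the window and have the same window sign are in the odd class together. -/
theorem odd_iff_of_out_sgn (haW : a + (m + 1) * L ≤ n) {x x' : Fin (n + 1) → Bool}
    (hout : ∀ j : Fin (n + 1), ¬ (a ≤ j.val ∧ j.val < a + (m + 1) * L) → x j = x' j)
    (hsgn : sgnW (xN x) a ((m + 1) * L) = sgnW (xN x') a ((m + 1) * L)) :
    (univ.filter fun j : Fin (n + 1) => x j = false).card % 2 = 1 ↔
      (univ.filter fun j : Fin (n + 1) => x' j = false).card % 2 = 1 := by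
  rw [card_zeros_eq haW x, card_zeros_eq haW x']
  have h1 : (univ.filter fun j : Fin (n + 1) => ¬ (a ≤ j.val ∧ j.val < a + (m + 1) * L) ∧ x j = false) =
      univ.filter fun j : Fin (n + 1) => ¬ (a ≤ j.val ∧ j.val < a + (m + 1) * L) ∧ x' j = false := by
    ext j; simp only [mem_filter, mem_univ, true_and]
    constructor
    · rintro ⟨h, hx⟩; exact ⟨h, by rw [← hout j h]; exact hx⟩
    · rintro ⟨h, hx⟩; exact ⟨h, by rw [hout j h]; exact hx⟩
  rw [h1]
  rw [sgnW_eq_ite, sgnW_eq_ite] at hsgn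
  have h2 : ((range ((m + 1) * L)).filter fun t => xN x (a + t) = false).card % 2 =
      ((range ((m + 1) * L)).filter fun t => xN x' (a + t) = false).card % 2 := by
    by_contra hne
    revert hsgn
    split_ifs <;> first | (intro h; exact absurd h (by decide)) | (intro; omega)
  omega

/-! ### The lifted Kilian gauge -/

variable (a L m κ₀)

/-- Boundary gauges: `1` at the two ends of the window, `h` at the `m` interior block boundaries. -/
def bdry (h : Fin m → Perm (ZMod 3)) (i : Fin (m + 2)) : Perm (ZMod 3) :=
  if h0 : i.val = 0 then 1 else if hl : i.val = m + 1 then 1 else h ⟨i.val - 1, by omega⟩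

/-- Gauged block words `h_j⁻¹ · G_j · h_{j+1}`. -/
def gauged (u : Fin (m + 2) → Perm (ZMod 3)) (G : Fin (m + 1) → Perm (ZMod 3)) (j : Fin (m + 1)) :
    Perm (ZMod 3) := (u j.castSucc)⁻¹ * G j * u j.succ

/-- The randomness of the lift: interior boundary gauges and a resampling table (`ρ j g ∈ fib(g)`). -/
abbrev Rand (L m : ℕ) (κ₀ : ZMod 3) : Type :=
  (Fin m → Perm (ZMod 3)) × ((j : Fin (m + 1)) → (g : Perm (ZMod 3)) → ↥(fib κ₀ L g))

/-- **The lift** `Ψ_r`: block `j` of the window of `x` is replaced by the table entry for its gauged word;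
all other bits are kept. -/
def psi (r : Rand L m κ₀) (x : Fin (n + 1) → Bool) : Fin (n + 1) → Bool :=
  glue a L m x (unblk L m fun j => ((r.2 j (gauged m (bdry m r.1) (Gblk a L m κ₀ x) j) : ↥(fib κ₀ L _)) :
    Fin L → Bool))

variable {a L m κ₀}

/-- The left end gauge is trivial. -/
@[simp] theorem bdry_zero (h : Fin m → Perm (ZMod 3)) : bdry m h 0 = 1 := by simp [bdry]

/-- The right end gauge is trivial. -/
@[simp] theorem bdry_last (h : Fin m → Perm (ZMod 3)) : bdry m h (Fin.last (m + 1)) = 1 := by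
  simp [bdry]

/-- **Telescoping**: `(G'_0 ⋯ G'_{i-1}) = u_0⁻¹ (G_0 ⋯ G_{i-1}) u_i`. -/
theorem partialProd_gauged (u : Fin (m + 2) → Perm (ZMod 3)) (G : Fin (m + 1) → Perm (ZMod 3)) :
    ∀ i : Fin (m + 2), Fin.partialProd (gauged m u G) i = (u 0)⁻¹ * Fin.partialProd G i * u i := by
  intro i
  induction i using Fin.induction with
  | zero => simp
  | succ i ih =>
    rw [Fin.partialProd_succ, Fin.partialProd_succ, ih, gauged]
    group

/-- With trivial end gauges the window word is preserved. -/
theorem partialProd_gauged_bdry (h : Fin m → Perm (ZMod 3)) (G : Fin (m + 1) → Perm (ZMod 3)) :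
    Fin.partialProd (gauged m (bdry m h) G) (Fin.last (m + 1)) = Fin.partialProd G (Fin.last (m + 1)) := by
  rw [partialProd_gauged, bdry_zero, bdry_last]; simp

/-- The block words of the lift are the gauged block words. -/
theorem Gblk_psi (haW : a + (m + 1) * L ≤ n) (r : Rand L m κ₀) (x : Fin (n + 1) → Bool) (j : Fin (m + 1)) :
    Gblk a L m κ₀ (psi a L m κ₀ r x) j = gauged m (bdry m r.1) (Gblk a L m κ₀ x) j := by
  unfold psi
  rw [Gblk_glue_unblk haW]
  exact (mem_fib_iff _ _).1 (r.2 j _).2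

/-- **The window word is invariant under the lift.** -/
theorem Pwin_psi (haW : a + (m + 1) * L ≤ n) (r : Rand L m κ₀) (x : Fin (n + 1) → Bool) :
    Pwin a L m κ₀ (psi a L m κ₀ r x) = Pwin a L m κ₀ x := by
  unfold Pwin
  rw [show Gblk a L m κ₀ (psi a L m κ₀ r x) = gauged m (bdry m r.1) (Gblk a L m κ₀ x) from
    funext (Gblk_psi haW r x), partialProd_gauged_bdry]

/-- The lift does not touch the outside bits. -/
theorem out_psi (r : Rand L m κ₀) (x : Fin (n + 1) → Bool) : out a L m (psi a L m κ₀ r x) = out a L m x :=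
  out_glue x _

/-- **The stake is invariant under the lift.** -/
theorem dk3_psi (hκ : KappaConst a L m κ₀ k) (haW : a + (m + 1) * L ≤ n) (hk : k ≤ n) (r : Rand L m κ₀)
    (x : Fin (n + 1) → Bool) : Dk3 (psi a L m κ₀ r x) k = Dk3 x k :=
  dk3_eq_of_out_Pwin hκ haW hk (fun _ hi => xN_glue_of_not_mem x _ hi) (Pwin_psi haW r x)

/-- **The odd class is invariant under the lift.** -/
theorem odd_psi_iff (hκ : KappaConst a L m κ₀ k) (haW : a + (m + 1) * L ≤ n) (r : Rand L m κ₀)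
    (x : Fin (n + 1) → Bool) :
    (univ.filter fun j : Fin (n + 1) => psi a L m κ₀ r x j = false).card % 2 = 1 ↔
      (univ.filter fun j : Fin (n + 1) => x j = false).card % 2 = 1 := by
  refine odd_iff_of_out_sgn haW (fun j hj => glue_apply_of_not_mem x _ hj) ?_
  have i1 := isAff_wp (kappa k) (xN (psi a L m κ₀ r x)) a ((m + 1) * L)
  have i2 := isAff_wp (kappa k) (xN x) a ((m + 1) * L)
  rw [← Pwin_eq_wp hκ] at i1 i2
  rw [Pwin_psi haW] at i1
  exact (i1.unique i2).1

/-! ### Locality: the lift has coordinate degree `≤ L` -/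

/-- **`g ∘ Ψ_r` has degree `≤ Δ·L`** for `g` of degree `≤ Δ` (`L ≥ 1`). -/
theorem comp_psi_mem_lowDeg (haW : a + (m + 1) * L ≤ n) (hL : 1 ≤ L) (r : Rand L m κ₀) {Δ : ℕ}
    {g : CubeFn (ZMod 3) (n + 1)} (hg : g ∈ lowDeg (ZMod 3) (n + 1) Δ) :
    (fun x => g (psi a L m κ₀ r x)) ∈ lowDeg (ZMod 3) (n + 1) (Δ * L) := by
  refine comp_mem_lowDeg_of_coord_mul (psi a L m κ₀ r) (fun i => ?_) hg
  by_cases hi : a ≤ i.val ∧ i.val < a + (m + 1) * L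
  · -- a window bit of block `j`: a function of the `L` bits of block `j` of `x`
    have hlt : i.val - a < (m + 1) * L := by omega
    let t : Fin ((m + 1) * L) := ⟨i.val - a, hlt⟩
    let j : Fin (m + 1) := (finProdFinEquiv.symm t).1
    let s' : Fin L := (finProdFinEquiv.symm t).2
    let S : Finset (Fin (n + 1)) :=
      (univ : Finset (Fin L)).image fun s => (⟨a + (s.val + L * j.val), by
        have := j.isLt; have := s.isLt; nlinarith⟩ : Fin (n + 1))
    have hcard : S.card ≤ L := by
      calc S.card ≤ (univ : Finset (Fin L)).card := Finset.card_image_le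
        _ = L := by simp
    refine lowDeg_mono hcard (ind_mem_lowDeg_of_dependsOn S (fun x => psi a L m κ₀ r x i) fun x x' hxx' => ?_)
    have hG : Gblk a L m κ₀ x j = Gblk a L m κ₀ x' j := by
      unfold Gblk
      congr 1
      funext s
      simp only [wblk, winOf, xN, finProdFinEquiv_apply_val]
      have hlt' : a + (s.val + L * j.val) < n + 1 := by have := j.isLt; have := s.isLt; nlinarith
      rw [dif_pos hlt', dif_pos hlt']
      exact hxx' _ (Finset.mem_image.2 ⟨s, mem_univ _, rfl⟩)
    have key : ∀ G G' : Fin (m + 1) → Perm (ZMod 3), G j = G' j →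
        (r.2 j (gauged m (bdry m r.1) G j)).1 s' = (r.2 j (gauged m (bdry m r.1) G' j)).1 s' := by
      intro G G' h; simp only [gauged]; rw [h]
    show glue a L m x _ i = glue a L m x' _ i
    rw [glue_apply_of_mem x _ hi, glue_apply_of_mem x' _ hi]
    exact key _ _ hG
  · -- an outside bit: the bit itself
    have heq : (fun x => if psi a L m κ₀ r x i = true then (1 : ZMod 3) else 0) =
        fun x => if x i = true then (1 : ZMod 3) else 0 := by
      funext x; rw [show psi a L m κ₀ r x i = x i from glue_apply_of_not_mem x _ hi]
    rw [heq]
    exact bitFn_mem_lowDeg i hL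

end Gauge

end DWalk

end Summit.QuantumAdvantage.AdviceFreeQNC0

end
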